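import Summits.HodgeConjecture.HodgeCM.PerL34.S5QautFock_1

/-! PORT of `HodgeCM/PerL34/S5QautFock.lean` (HodgeCMPerL run 82) — part 2: continuation of `Summits.HodgeConjecture.HodgeCM.PerL34.S5QautFock_1` (split at a top-level declaration boundary by port_pkg.py; scope re-opened below; declarations unchanged). -/

-- port_pkg: scope re-opened for this part (file-level context, then the namespace/section stack open at the cut)
set_option autoImplicit false
noncomputable section
open MeasureTheory Matrix MvPolynomial
open HodgeCM.Prior.Perl34File
open HodgeCM.PerL34.Qaut
open HodgeCM.PerL34.P43KTypesU2 (mat mat_mul_star pPlus pPlus_apply fockRep fockRep_apply diagK mat_diagK diagK_snd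
  fockRep_diagK_monomial jplusSubmodule mem_jplusSubmodule Jplus Jplus_apply_coe zLin zLin_apply zLin_equivariant
  zLin_mem_jplus coeff_zLin)
namespace HodgeCM
namespace PerL34
namespace QautFock
variable {U : Universe} (T : U.ThetaModel)
variable {L : CMField} {ι₁ : L →+* ℂ} (V : HermSpace3 L ι₁) (c : SeesawCtx L)
variable (D : Perl34.TorusData (T.core V c)) (k l : Fin 4)
/-- **The S5 bridge record, `N19g` half, over the explicit Fock `J⁺`-piece.**  See the module docstring for the label
of every field; compared with `QautDictionary.QautBridge` the fields `ρ, ρ_cont, ρ_det, ρ_k₀, ξ, …, Forms₁, Forms₂,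
isForm₁, isForm₂, decomp` are GONE (defined / derived below), replaced by `κ`, the theta maps `Ψ₁, Ψ₂` with their
`K`-equivariance, and the verbatim (eq:seesaw)-on-pure-tensors field `seesawPure`. -/
structure QautFockBridge where
  /-- SHELL (D5): `K_∞` (or any compact group through which right translation acts) -/
  K : Type
  [instK₁ : Group K]
  [instK₂ : TopologicalSpace K]
  [instK₃ : IsTopologicalGroup K]
  [instK₄ : MeasurableSpace K]
  [instK₅ : BorelSpace K]
  [instK₆ : CompactSpace K]
  /-- its Haar probability measure -/
  μ : Measure K
  [instμ₁ : IsProbabilityMeasure μ]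
  [instμ₂ : μ.IsMulLeftInvariant]
  [instμ₃ : μ.IsMulRightInvariant]
  /-- SHELL (D5): a commutative Banach algebra of bounded right-uniformly continuous functions on `G_U(L₀)\G_U(𝔸)` -/
  C : Type
  [instC₁ : NormedCommRing C]
  [instC₂ : NormedAlgebra ℂ C]
  [instC₃ : CompleteSpace C]
  /-- right translation by `K` (algebra automorphisms), strongly continuous -/
  σ : K →* (C →ₐ[ℂ] C)
  σ_cont : ∀ f : C, Continuous fun x => σ x f
  /-- DICTIONARY (D2): the projection `K_∞ → K_{ι₁} = U(2) × U(1)` (continuous homomorphism) -/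
  κ : K →* P43KTypesU2.K
  κ_cont : Continuous κ
  /-- DICTIONARY (D2: `K_{ι₁}` is a direct factor of `K_∞`): a torus element with distinct `𝔭₊`-weights and a Weyl
  element lie in the image -/
  ρ_diag : ∃ x s t, s ≠ t ∧ pPlusMat (κ x) = !![s, 0; 0, t]
  ρ_antidiag : ∃ x a b, pPlusMat (κ x) = !![0, a; b, 0]
  /-- the central `U(1)_V`: `κ k₀ = (1₂, d₀)`, `d₀` of infinite order -/
  k₀ : K
  d₀ : unitary ℂ
  κ_k₀ : κ k₀ = diagK 1 1 d₀
  d₀_pow_ne_one : ∀ m : ℕ, 1 ≤ m → (d₀ : ℂ) ^ m ≠ 1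
  /-- DICTIONARY (D5): the `L²` class of a function of the shell -/
  toHG : C →ₗ[ℂ] T.HG L ι₁ V
  /-- DEFINITIONAL (D4): the theta maps `p ↦ θ(p ⊗ φ^{ι₁,c}, χ'_1)` (resp. `χ'_2`) of the two sides at `χ = χ'_1 ⊠ χ'_2`,
  on the `J⁺`-piece of the `ι₁` Fock model (Lemma 4.1(a): only the `χ̄'_{ι₁}`-isotypic part contributes) -/
  Ψ₁ : D.X → Set (jplusSubmodule →ₗ[ℂ] C)
  Ψ₂ : D.X → Set (jplusSubmodule →ₗ[ℂ] C)
  /-- DICTIONARY (D4/D5, `K`-type transport l. 362–363): theta maps are `K`-equivariant for the Fock action at `ι₁` -/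
  equiv₁ : ∀ χ, ∀ ψ ∈ Ψ₁ χ, ∀ (x : K) (p : jplusSubmodule), σ x (ψ p) = ψ (Jplus (κ x) p)
  equiv₂ : ∀ χ, ∀ ψ ∈ Ψ₂ χ, ∀ (x : K) (p : jplusSubmodule), σ x (ψ p) = ψ (Jplus (κ x) p)
  /-- DICTIONARY (D2 + (Qaut) §3.1 + Lemma 3.3(a); l. 371–372, ll. 655–657): the wedge of the canonical theta one-forms of
  an allowed character is a `(k,l)`-wedge-function of the model -/
  wedge_mem : ∀ χ, D.allowed χ → ∀ ψ ∈ Ψ₁ χ, ∀ ψ' ∈ Ψ₂ χ, toHG (wedge (formOf ψ) (formOf ψ')) ∈ T.wedgeSet V c k l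
  /-- D4 + PRINT (density of `K`-finite vectors): the dense subspace `pr_κ(𝒫) ⊆ 𝒮^κ` -/
  P : Set (T.SK V c)
  dense : Dense P
  /-- DICTIONARY ((eq:seesaw) on pure tensors with Fock-polynomial archimedean components, N17; l. 360–362):
  `ϑ_{T,χ}(pr_κ(φ₁ ⊗ φ₂)) = pr_κ(θ(φ₁,χ'₁) θ(φ₂,χ'₂))`, summed over the finitely many pure tensors making up `Φ ∈ P` -/
  seesawPure : ∀ χ, D.allowed χ → ∀ Φ ∈ P, ∃ (n : ℕ) (ψ₁ ψ₂ : Fin n → (jplusSubmodule →ₗ[ℂ] C))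
    (p₁ p₂ : Fin n → jplusSubmodule), (∀ i, ψ₁ i ∈ Ψ₁ χ ∧ ψ₂ i ∈ Ψ₂ χ) ∧
      D.ϑ χ Φ = toHG (∑ i, pr μ (pPlusMat.comp κ) σ (ψ₁ i (p₁ i) * ψ₂ i (p₂ i)))

attribute [instance] QautFockBridge.instK₁ QautFockBridge.instK₂ QautFockBridge.instK₃ QautFockBridge.instK₄
  QautFockBridge.instK₅ QautFockBridge.instK₆ QautFockBridge.instμ₁ QautFockBridge.instμ₂ QautFockBridge.instμ₃
  QautFockBridge.instC₁ QautFockBridge.instC₂ QautFockBridge.instC₃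

namespace QautFockBridge

variable {T V c D k l}
variable (B : QautFockBridge T V c D k l)

/-- `𝔭₊` of the shell: DEFINED as `pPlusMat ∘ κ` (not posited). -/
def ρ : B.K →* Matrix (Fin 2) (Fin 2) ℂ := pPlusMat.comp B.κ

/-- (Ported verbatim from the HodgeCMPerL package; no docstring in the source.) -/
theorem ρ_apply (x : B.K) : B.ρ x = pPlusMat (B.κ x) := rfl

/-- (Ported verbatim from the HodgeCMPerL package; no docstring in the source.) -/
theorem ρ_cont : Continuous fun x => B.ρ x := continuous_pPlusMat.comp B.κ_cont

/-- (Ported verbatim from the HodgeCMPerL package; no docstring in the source.) -/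
theorem ρ_det (x : B.K) : IsUnit (B.ρ x).det := isUnit_det_pPlusMat (B.κ x)

/-- (Ported verbatim from the HodgeCMPerL package; no docstring in the source.) -/
theorem ρ_diag' : ∃ x s t, s ≠ t ∧ B.ρ x = !![s, 0; 0, t] := B.ρ_diag

/-- (Ported verbatim from the HodgeCMPerL package; no docstring in the source.) -/
theorem ρ_antidiag' : ∃ x a b, B.ρ x = !![0, a; b, 0] := B.ρ_antidiag

/-- the scalar `ξ = d̄₀` by which `k₀` acts on `𝔭₊` -/
def ξ : ℂ := star (B.d₀ : ℂ)

/-- (Ported verbatim from the HodgeCMPerL package; no docstring in the source.) -/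
theorem ξ_ne_zero : B.ξ ≠ 0 := star_coe_ne_zero B.d₀

/-- (Ported verbatim from the HodgeCMPerL package; no docstring in the source.) -/
theorem ξ_pow_ne_one (m : ℕ) (hm : 1 ≤ m) : B.ξ ^ m ≠ 1 := star_pow_ne_one B.d₀_pow_ne_one m hm

/-- (Ported verbatim from the HodgeCMPerL package; no docstring in the source.) -/
theorem det_ρ_k₀ : (B.ρ B.k₀).det = B.ξ ^ 2 := by
  rw [ρ_apply, B.κ_k₀, det_pPlusMat_diagK_one]; rfl

/-- The canonical theta one-forms of side 1 (resp. 2) at `χ`. -/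
def Forms₁ (χ : D.X) : Set ((Fin 2 → ℂ) →ₗ[ℂ] B.C) := {u | ∃ ψ ∈ B.Ψ₁ χ, u = formOf ψ}
/-- see `Forms₁` -/
def Forms₂ (χ : D.X) : Set ((Fin 2 → ℂ) →ₗ[ℂ] B.C) := {u | ∃ ψ ∈ B.Ψ₂ χ, u = formOf ψ}

/-- **A canonical theta one-form IS a form** in pv02's sense (`σ x (u v) = u (𝔭₊(x) v)`), by `K`-equivariance of the
theta map and of `𝔭₊ ↪ J⁺`. -/
theorem isForm_formOf {ψ : jplusSubmodule →ₗ[ℂ] B.C}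
    (h : ∀ (x : B.K) (p : jplusSubmodule), B.σ x (ψ p) = ψ (Jplus (B.κ x) p)) : IsForm B.ρ B.σ (formOf ψ) := by
  intro x v
  rw [formOf_apply, formOf_apply, h, ρ_apply, pPlusMat_mulVec, zLinJ_equivariant]

/-- (Ported verbatim from the HodgeCMPerL package; no docstring in the source.) -/
theorem isForm₁ (χ : D.X) : ∀ u ∈ B.Forms₁ χ, IsForm B.ρ B.σ u := by
  rintro _ ⟨ψ, hψ, rfl⟩; exact B.isForm_formOf (B.equiv₁ χ ψ hψ)

/-- (Ported verbatim from the HodgeCMPerL package; no docstring in the source.) -/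
theorem isForm₂ (χ : D.X) : ∀ u ∈ B.Forms₂ χ, IsForm B.ρ B.σ u := by
  rintro _ ⟨ψ, hψ, rfl⟩; exact B.isForm_formOf (B.equiv₂ χ ψ hψ)

/-- (iii) in the shell: the image of the `n`-th part of `p` under a theta map has `k₀`-weight `ξ ^ n`. -/
theorem sigma_k₀_zPartJ {ψ : jplusSubmodule →ₗ[ℂ] B.C}
    (h : ∀ (x : B.K) (p : jplusSubmodule), B.σ x (ψ p) = ψ (Jplus (B.κ x) p)) (n : ℕ) (p : jplusSubmodule) :
    B.σ B.k₀ (ψ (zPartJ n p)) = B.ξ ^ n • ψ (zPartJ n p) := by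
  rw [h, B.κ_k₀, Jplus_diagK_one_zPartJ, map_smul]; rfl

/-- (iv) in the shell: the image of the first part is a component of the canonical one-form. -/
theorem zPartJ_one_mem_span {Ψ : Set (jplusSubmodule →ₗ[ℂ] B.C)} {ψ : jplusSubmodule →ₗ[ℂ] B.C}
    (hψ : ψ ∈ Ψ) (p : jplusSubmodule) :
    ψ (zPartJ 1 p) ∈ Submodule.span ℂ {f | ∃ u ∈ {u | ∃ ψ ∈ Ψ, u = formOf ψ}, ∃ x, f = u x} := by
  refine Submodule.subset_span
    ⟨formOf ψ, ⟨ψ, hψ, rfl⟩, fun a => coeff (Finsupp.single (Sum.inl a) 1) (p : Fock.HarmModel), ?_⟩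
  rw [zPartJ_one_eq, formOf_apply]

/-- the wedge span of the canonical forms at `χ` -/
def wedgeSpan (χ : D.X) : Submodule ℂ B.C :=
  Submodule.span ℂ {g | ∃ u ∈ B.Forms₁ χ, ∃ v ∈ B.Forms₂ χ, g = wedge u v}

/-- **One pure term, one pair of `K`-types** — PerL ll. 367–372: if `(n₁,n₂) ≠ (1,1)` the `κ`-projection of the product
VANISHES (`Qaut.pr_mul_eq_zero_of_weights`, `ξ^{n₁} ξ^{n₂} ≠ ξ² = det 𝔭₊(k₀)`); if `n₁ = n₂ = 1` both factors are
components of the canonical theta one-forms and `pr` of the product is the wedge combination of §3.1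
(`Qaut.pr_mul_mem_span_wedge`). -/
theorem pr_parts_mem (χ : D.X) {ψ₁ ψ₂ : jplusSubmodule →ₗ[ℂ] B.C} (h₁ : ψ₁ ∈ B.Ψ₁ χ) (h₂ : ψ₂ ∈ B.Ψ₂ χ)
    (p₁ p₂ : jplusSubmodule) {n₁ n₂ : ℕ} (hn₁ : 1 ≤ n₁) (hn₂ : 1 ≤ n₂) :
    pr B.μ B.ρ B.σ (ψ₁ (zPartJ n₁ p₁) * ψ₂ (zPartJ n₂ p₂)) ∈ B.wedgeSpan χ := by
  by_cases h : n₁ = 1 ∧ n₂ = 1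
  · obtain ⟨rfl, rfl⟩ := h
    exact pr_mul_mem_span_wedge B.ρ_cont B.ρ_det B.σ_cont B.ρ_diag' B.ρ_antidiag' (B.Forms₁ χ) (B.Forms₂ χ)
      (B.isForm₁ χ) (B.isForm₂ χ) (B.zPartJ_one_mem_span h₁ p₁) (B.zPartJ_one_mem_span h₂ p₂)
  · have hne : B.ξ ^ n₁ * B.ξ ^ n₂ ≠ (B.ρ B.k₀).det := by
      rw [det_ρ_k₀]; exact pow_mul_pow_ne_sq B.ξ_ne_zero B.ξ_pow_ne_one hn₁ hn₂ h
    rw [pr_mul_eq_zero_of_weights B.ρ_det B.k₀ (B.sigma_k₀_zPartJ (B.equiv₁ χ ψ₁ h₁) n₁ p₁)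
      (B.sigma_k₀_zPartJ (B.equiv₂ χ ψ₂ h₂) n₂ p₂) hne]
    exact Submodule.zero_mem _

/-- **One pure term** `pr(θ(φ₁,χ'₁) θ(φ₂,χ'₂))` lies in the wedge span: expand both factors into their `K_V`-type parts
(`sum_zPartJ`), all of index `≥ 1` (`one_le_of_mem_zDegs`), and apply `pr_parts_mem` termwise (`pr` is linear:
pv02 `Qaut.prL`). -/
theorem pr_pure_mem (χ : D.X) {ψ₁ ψ₂ : jplusSubmodule →ₗ[ℂ] B.C} (h₁ : ψ₁ ∈ B.Ψ₁ χ) (h₂ : ψ₂ ∈ B.Ψ₂ χ)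
    (p₁ p₂ : jplusSubmodule) : pr B.μ B.ρ B.σ (ψ₁ p₁ * ψ₂ p₂) ∈ B.wedgeSpan χ := by
  rw [← sum_zPartJ p₁, ← sum_zPartJ p₂, map_sum, map_sum, Finset.sum_mul_sum, ← prL_apply B.ρ_cont B.ρ_det B.σ_cont,
    map_sum]
  refine Submodule.sum_mem _ fun n₁ hn₁ => ?_
  rw [map_sum]
  refine Submodule.sum_mem _ fun n₂ hn₂ => ?_
  rw [prL_apply]
  exact B.pr_parts_mem χ h₁ h₂ p₁ p₂ (one_le_of_mem_zDegs p₁.2 hn₁) (one_le_of_mem_zDegs p₂.2 hn₂)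

/-- The dictionary field `wedge_mem` on spans. -/
theorem map_wedgeSpan_le (χ : D.X) (hχ : D.allowed χ) :
    (B.wedgeSpan χ).map B.toHG ≤ Submodule.span ℂ (T.wedgeSet V c k l) := by
  rw [wedgeSpan, Submodule.map_span, Submodule.span_le]
  rintro _ ⟨g, ⟨u, ⟨ψ, hψ, rfl⟩, v, ⟨ψ', hψ', rfl⟩, rfl⟩, rfl⟩
  exact Submodule.subset_span (B.wedge_mem χ hχ ψ hψ ψ' hψ')

end QautFockBridge

variable {T V c D k l}

/-- **Seam S5, `N19g` half, from the sharpened record (KERNEL modulo the dictionary fields of `QautFockBridge`):**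
the `K`-type list of `J⁺`, the `U(1)`-weight count and the wedge combination of PerL ll. 362–372 are all discharged in
the kernel over pv12/pv14's Fock model and pv02's shell. -/
theorem N19g_core_of_fockBridge (B : QautFockBridge T V c D k l) : N19g_core T V c D k l := by
  refine ⟨B.P, B.dense, fun χ hχ Φ hΦ => ?_⟩
  obtain ⟨n, ψ₁, ψ₂, p₁, p₂, hmem, hϑ⟩ := B.seesawPure χ hχ Φ hΦ
  rw [hϑ]
  refine B.map_wedgeSpan_le χ hχ (Submodule.mem_map.mpr ⟨_, ?_, rfl⟩)
  exact Submodule.sum_mem _ fun i _ => B.pr_pure_mem χ (hmem i).1 (hmem i).2 (p₁ i) (p₂ i)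

/-- The landed S5 record follows (pv08-g2 `S5ConservativeQaut.nonempty_qautBridge_iff`): the sharper record is at least
as strong. -/
theorem nonempty_qautBridge_of_fockBridge (B : QautFockBridge T V c D k l) :
    Nonempty (QautDictionary.QautBridge T V c D k l) :=
  (S5ConservativeQaut.nonempty_qautBridge_iff T V c D k l).mpr (N19g_core_of_fockBridge B)

/-- Lemma 3.5 (gen ⊆ closed wedge span) for the side, from the sharpened record. -/
theorem N19_genIn_of_fockBridge (B : QautFockBridge T V c D k l) : N19_genIn T V c D k l :=
  N19g_of T V c D k l (N19g_core_of_fockBridge B)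

variable (T) in
/-- **pv08's adapter with its hypothesis DISCHARGED from the sharpened records:** a Fock bridge at every good context
for the (34) side gives the realisation input `Open_thetaReal34` (the `h19g` of `perL_of_nodes`). -/
theorem open_thetaReal34_of_fockBridges
    (hB : ∀ {L : CMField} {ι₁ : L →+* ℂ} (V : HermSpace3 L ι₁) (c : SeesawCtx L), T.GoodCtx ι₁ c →
      Nonempty (QautFockBridge T V c (T.t34 V c) 2 3)) :
    T.Open_thetaReal34 :=
  open_thetaReal34_of_core T fun V c hc => (hB V c hc).elim fun B => N19g_core_of_fockBridge B

end QautFock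
end PerL34
end HodgeCM

end
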